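import Mathlib.RingTheory.Polynomial.Hermite.Gaussian
import Mathlib.Analysis.SpecialFunctions.Gaussian.GaussianIntegral
import Literature.Analysis.FluidPDE.StretchedLayerNS
import HarnessLib

/-!
# Beronov–Kida 1996: two-dimensional linear stability of the Burgers vortex layer —
# the layer Reynolds number, the normal-mode problem, the Hermite ladder of the long-wave
# analysis (PROVED), and the printed neutral-curve numbers (DATA; no named fact)

K. N. Beronov, S. Kida, *Linear two-dimensional stability of a Burgers vortex layer*,
Phys. Fluids **8** (1996) 1024–1035 [BeronovKida1996]; text held as the RIMS Kōkyūroku **921**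
(1995) 58–88 version «Two-dimensional linear neutral stability of the stationary Burgers vortex
layer» (`paper:url-32636f6e7b06`, chunks p0001–p0031; every locator `pNNNN Lnn` below refers to
that text; equation numbers are the preprint's).

HONEST FRAMING (cell `ns-blowup`, crux idea «layer-reynolds-gate» on item
stmt-NavierStokesRegularity-19179; bus item C20 of `ns-lit-coord-1`). Beronov–Kida study the
LINEARISED two-dimensional stability of the Burgers vortex layer — the exact steady
Navier–Stokes solution `U = (U(y), −Ay, Az)` with Gaussian vorticity
`Ω(y) = (Γ/√(2π)) √(A/ν) exp(−y²A/(2ν))` ((2.1), p0003 L13), in the tree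
`burgersLayer γ ν ΔU` / `burgersShearLayer γ ν ΔU` of `BurgersVortexLayer` /
`StretchedLayerNS` with `A = γ`, `Γ = ΔU` — against normal modes `φ(y) e^{iα(x − ct)}`
invariant along the vorticity. What they PRINT:

* the **layer Reynolds number** `R = (Γ/2)/√(Aν)` ((2.2), p0003 L18–20: length unit the layer
  thickness `δ = √(ν/A)`, velocity unit `U(+∞) = Γ/2`; abstract p0001 L12–13: «The Reynolds
  number compares shear flow vorticity versus stretching rate and diffusion»);
* the modified Orr–Sommerfeld problem (2.7) ≡ (2.9) with exponential vorticity decay (2.10)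
  (p0004 L30 – p0005 L13) about the nondimensional profile `U = h₋₁`, `U' = h₀ = √(2/π) e^{−y²/2}`
  ((B.1), p0021 L25), growth rate `α cᵢ` (p0004 L31);
* the long-wave analysis §III.A: the `x`-independent part of (2.7) is the Hermite operator
  `𝓜 = D(D + y) = D² + yD + 1` ((3.5)) with the Gaussian–Hermite ladder `hₙ = Dⁿh₀`,
  `𝓜hₙ = −n hₙ` ((B.8), p0022 L17–19; «follows inductively … by noting that
  `D𝓜Dⁿ = (𝓜 + 1)Dⁿ⁺¹`»), so that to leading order the modes are `λ₀ = 0, −1, −2, …`: «very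
  strong damping» `α cᵢ = −n/R` except for the ONE leading-order-neutral (layer-strength,
  Gaussian) mode `λ₀ = 0`, `ω₀ = h₀ − iR₀h₁` ((3.13)–(3.14), p0007 L20–30); the solvability
  condition at second order «`0 = 2(λ₂ − R₀²)` … imply `λ₂ = 1`, `R₀ = 1`» ((3.21), p0009 L1–5)
  and at third order `R₁ = 3/√π = 1.6926 > 0`, `R = 1 + (3/√π)α + O(α²)` ((3.24), p0010 L1–4);
* the large-`R` (inviscid, Rayleigh) end: `a₀ = 0.537`, `α_cr = √a₀ = 0.733` ((3.35), p0011
  L24–26), `a₁ = −0.927` ((3.38)), `α_cr(R) = 0.733 − 0.863/R + O(R⁻²)` ((3.39), p0012 L8–9);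
* the numerically computed (shooting) neutral curve, §IV.C (p0016 L12–31): neutral wavenumbers
  `α = 0.57, 0.65, 0.69` at `R = 5, 10, 20` and `0.73` at `R = ∞` «by the present method»
  (Lin–Corcos 1984 growth-rate zero crossings, rescaled: `0.53, 0.63, 0.69, 0.73`), and the
  conclusion «a finite critical Reynolds number exists, `R_cr = 1`. It is obtained at the
  small-wavenumber end of the neutral curve, and no lower branch exists, at least for standing
  wave normal modes. The numerical curve is strictly monotonic» (p0016 L29–31); abstract: «there
  is unconditional stability below a critical Reynolds number, in agreement with the long-wave
  asymptotic result by Neu (J. Fluid Mech. 143 (1984) 253)» (p0001 L10–12), Neu's `R'_cr = √(2π)`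
  in his units «corresponds to `R_cr = 1` here» (p0003 L21–22) [Neu1984].

WHAT IS PROVED HERE (kernel; `0` named facts): §1 the definition `burgersLayerReynolds ΔU γ ν`
and its printed readings as identities — Reynolds number of the half-jump on the layer thickness
(`…_eq_half_jump_mul_thickness_div`), «shear vorticity versus stretching rate»
`R = √(π/2)·U_B'(0)/γ` on the tree's `burgersLayerProfileD` (`…_eq_peakShear`), invariance under
the Navier–Stokes scaling (`…_scale`), the unit-viscosity form `R = (θ/2)√(Y²/A)` used by the
crux idea's register arithmetic (`…_unit_viscosity`), and the threshold-inequality shapes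
`R < R⋆ ↔ ΔU < 2R⋆√(γν)` / `R⋆ ≤ R ↔ 2R⋆√(γν) ≤ ΔU` (the «layer-Reynolds gate» is an inequality
on a time slice: velocity jump across the layer vs. strain normal to it); §2 BK's nondimensional
profile `U = h₋₁` with `U' = h₀`, `U'' = −y h₀`, `U(±∞) = ±1`, `∫h₀ = 2`, `∫h₀² = 2/√π` ((B.1),
(B.9)) and the DICTIONARY `burgersLayerProfile γ ν ΔU (δ·y) = (ΔU/2)·U(y)`, `δ = √(ν/γ)` (BK's
units are the tree's layer); §3 the normal-mode problem (2.7)/(2.10) and 2-D linear stability as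
DEFINITIONS; §4 **the Hermite ladder `𝓜hₙ = −n·hₙ` for every `n`** ((B.8); via Mathlib's
`Polynomial.hermite`: `hₙ = (−1)ⁿ Heₙ · h₀` and the Hermite equation
`Heₙ'' − X·Heₙ' = −n·Heₙ`, proved here from `hermite_succ`), i.e. the leading-order spectrum
`{0, −1, −2, …}` of (3.13) with the Gaussian (layer-strength) mode neutral; §5 the printed numbers
as DATA with the arithmetic checks that are arithmetic (`R₀ = 1` from the printed solvability
relation; `|3/√π − 1.6926| < 10⁻⁴`; `|√0.537 − 0.733| < 10⁻³`; `|0.927/(2·0.537) − 0.863| < 10⁻³`).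

WHAT THIS IS NOT / NOT ASSERTED: no statement about Navier–Stokes regularity or blow-up; not a
theorem that `R_cr = 1` — in print the threshold rests on FORMAL matched asymptotics (§III) and a
shooting computation (§IV), so under the tree's rule «conjectures / unproved claims are not
Literature facts» the threshold is typed as DATA (`criticalReynolds`) next to the PREDICATE it is
about (`IsCriticalReynolds`; BK's printed conclusion reads `IsCriticalReynolds criticalReynolds`,
deliberately NOT declared as a named fact); nothing three-dimensional (BK p0004 L17–19:
«three-dimensional linear stability is then left an open problem»), nothing nonlinear (Neu 1984,
Passot et al. 1995, Lin–Corcos 1984 are cited in prose only); completeness of the Hermite ladder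
(that the `hₙ` exhaust the fast-decaying eigenfunctions of `𝓜`, (B.5)) is not proved.

## References

* K. N. Beronov, S. Kida, Phys. Fluids 8 (1996) 1024–1035, doi:10.1063/1.868879 = RIMS Kōkyūroku
  921 (1995) 58–88: abstract; §II (2.1)–(2.10); §III.A (3.5), (3.13)–(3.14), (3.21), (3.24);
  §III.B (3.35), (3.38)–(3.39); §IV.C; App. B (B.1), (B.8), (B.9). [BeronovKida1996]
* J. C. Neu, *The dynamics of stretched vortices*, JFM 143 (1984) 253–276 (long-wave threshold
  `R'_cr = √(2π)` in Neu's units; quoted from BK p0003 L21–22, not held). [Neu1984]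
* S. J. Lin, G. M. Corcos, JFM 141 (1984) 139–178 (growth rates for `R ≥ 5`, BK §IV.C). [LinCorcos1984]
-/

noncomputable section

open Polynomial MeasureTheory intervalIntegral Set Filter
open scoped Real

namespace Literature.Analysis.FluidPDE

open _root_.Real (sqrt exp)
open _root_.Topology

/-! ## §1 The layer Reynolds number (BK (2.2)) -/

/-- The **Reynolds number of the Burgers vortex layer** with velocity jump `ΔU`, compressive /
stretching strain rate `γ` and viscosity `ν`: `R = (ΔU/2)/√(γν)` — the half-jump `ΔU/2 = U(+∞)`
measured on the layer thickness `δ = √(ν/γ)` (Beronov–Kida's `Γ = ΔU`, `A = γ`; junk value when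
`γν ≤ 0`, where `√(γν) = 0` and Lean's `x/0 = 0` give `R = 0`).
[cite: BeronovKida1996, §II.A eq. (2.2) (RIMS 921 text p0003 L18–20)] -/
def burgersLayerReynolds (ΔU γ ν : ℝ) : ℝ :=
  ΔU / 2 / sqrt (γ * ν)

/-- Unfolding. [cite: BeronovKida1996, §II.A eq. (2.2) (p0003 L20)] -/
theorem burgersLayerReynolds_eq (ΔU γ ν : ℝ) :
    burgersLayerReynolds ΔU γ ν = ΔU / (2 * sqrt (γ * ν)) := by
  rw [burgersLayerReynolds, div_div]

/-- `R > 0` for a genuine layer (`ΔU, γ, ν > 0`). [cite: BeronovKida1996, §II.A eq. (2.2) (p0003 L20)] -/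
theorem burgersLayerReynolds_pos {ΔU γ ν : ℝ} (hΔU : 0 < ΔU) (hγ : 0 < γ) (hν : 0 < ν) :
    0 < burgersLayerReynolds ΔU γ ν := by
  unfold burgersLayerReynolds
  have : 0 < sqrt (γ * ν) := Real.sqrt_pos.2 (mul_pos hγ hν)
  positivity

/-- `R ≥ 0` whenever `ΔU ≥ 0`. [cite: BeronovKida1996, §II.A eq. (2.2) (p0003 L20)] -/
theorem burgersLayerReynolds_nonneg {ΔU : ℝ} (hΔU : 0 ≤ ΔU) (γ ν : ℝ) :
    0 ≤ burgersLayerReynolds ΔU γ ν := by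
  unfold burgersLayerReynolds
  have : 0 ≤ sqrt (γ * ν) := Real.sqrt_nonneg _
  positivity

/-- **`R` is the Reynolds number of the half-jump on the layer thickness**:
`R = (ΔU/2)·δ/ν` with `δ = burgersLayerThickness γ ν = √(ν/γ)` (BK: «the vortex layer thickness
`δ = √(ν/A)` as the natural unit of length … velocity scale `U(+∞) = Γ/2`»).
[cite: BeronovKida1996, §II.A (2.2) (p0003 L18–20)] -/
theorem burgersLayerReynolds_eq_half_jump_mul_thickness_div {γ ν : ℝ} (hγ : 0 < γ) (hν : 0 < ν)
    (ΔU : ℝ) :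
    burgersLayerReynolds ΔU γ ν = ΔU / 2 * burgersLayerThickness γ ν / ν := by
  unfold burgersLayerReynolds burgersLayerThickness
  obtain ⟨a, ha, rfl⟩ : ∃ a : ℝ, 0 < a ∧ γ = a ^ 2 :=
    ⟨sqrt γ, Real.sqrt_pos.2 hγ, (Real.sq_sqrt hγ.le).symm⟩
  obtain ⟨b, hb, rfl⟩ : ∃ b : ℝ, 0 < b ∧ ν = b ^ 2 :=
    ⟨sqrt ν, Real.sqrt_pos.2 hν, (Real.sq_sqrt hν.le).symm⟩
  have h1 : sqrt (a ^ 2 * b ^ 2) = a * b := by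
    rw [Real.sqrt_mul (sq_nonneg a), Real.sqrt_sq ha.le, Real.sqrt_sq hb.le]
  have h2 : sqrt (b ^ 2 / a ^ 2) = b / a := by
    rw [Real.sqrt_div (sq_nonneg b), Real.sqrt_sq ha.le, Real.sqrt_sq hb.le]
  rw [h1, h2]
  field_simp

/-- **«The Reynolds number compares shear flow vorticity versus stretching rate»**: with the
tree's derivative `U_B' = burgersLayerProfileD γ ν ΔU` of the Burgers layer profile (peak value
`U_B'(0) = ΔU·(γ/2πν)^{1/2}`, the peak vorticity magnitude of the layer),
`R = √(π/2) · U_B'(0) / γ`. [cite: BeronovKida1996, abstract (p0001 L12–13) with (2.1)–(2.2) (p0003 L13–20)] -/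
theorem burgersLayerReynolds_eq_peakShear {γ ν : ℝ} (hγ : 0 < γ) (hν : 0 < ν) (ΔU : ℝ) :
    burgersLayerReynolds ΔU γ ν = sqrt (π / 2) * burgersLayerProfileD γ ν ΔU 0 / γ := by
  unfold burgersLayerReynolds burgersLayerProfileD burgersLayerRate
  simp only [mul_zero, ne_eq, OfNat.ofNat_ne_zero, not_false_eq_true, zero_pow, neg_zero,
    Real.exp_zero, mul_one]
  obtain ⟨a, ha, rfl⟩ : ∃ a : ℝ, 0 < a ∧ γ = a ^ 2 :=
    ⟨sqrt γ, Real.sqrt_pos.2 hγ, (Real.sq_sqrt hγ.le).symm⟩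
  obtain ⟨b, hb, rfl⟩ : ∃ b : ℝ, 0 < b ∧ ν = b ^ 2 :=
    ⟨sqrt ν, Real.sqrt_pos.2 hν, (Real.sq_sqrt hν.le).symm⟩
  have hs2 : 0 < sqrt 2 := Real.sqrt_pos.2 two_pos
  have hsπ : 0 < sqrt π := Real.sqrt_pos.2 Real.pi_pos
  have h1 : sqrt (a ^ 2 * b ^ 2) = a * b := by
    rw [Real.sqrt_mul (sq_nonneg a), Real.sqrt_sq ha.le, Real.sqrt_sq hb.le]
  have h2 : sqrt (a ^ 2 / (2 * b ^ 2)) = a / (sqrt 2 * b) := by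
    rw [Real.sqrt_div (sq_nonneg a), Real.sqrt_sq ha.le, Real.sqrt_mul zero_le_two,
      Real.sqrt_sq hb.le]
  have h3 : sqrt (π / 2) = sqrt π / sqrt 2 := Real.sqrt_div Real.pi_pos.le 2
  have h4 : (2 : ℝ) = sqrt 2 ^ 2 := (Real.sq_sqrt zero_le_two).symm
  conv_lhs => rw [h4]
  rw [h1, h2, h3]
  field_simp

/-- **Invariance under the Navier–Stokes scaling** `u ↦ l·u(l·x, l²·t)` (`ΔU ↦ lΔU`, `γ ↦ l²γ`,
`ν` fixed): `R` is dimensionless. [cite: BeronovKida1996, §II.A (2.2) (p0003 L18–20)] -/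
theorem burgersLayerReynolds_scale {l : ℝ} (hl : 0 < l) (ΔU γ ν : ℝ) :
    burgersLayerReynolds (l * ΔU) (l ^ 2 * γ) ν = burgersLayerReynolds ΔU γ ν := by
  unfold burgersLayerReynolds
  rw [mul_assoc, Real.sqrt_mul (sq_nonneg l), Real.sqrt_sq hl.le, mul_div_assoc]
  exact mul_div_mul_left _ _ hl.ne'

/-- **Unit-viscosity form**: a layer with jump `θ·Y` in a strain `A` at `ν = 1` has
`R = (θ/2)·√(Y²/A)` (`Y ≥ 0`; `Y²/A` is the Reynolds number of the velocity scale `Y` on the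
strain length `√(1/A)` — the form in which the crux idea «layer-reynolds-gate» reads a register
level). [cite: BeronovKida1996, §II.A (2.2) (p0003 L18–20)] -/
theorem burgersLayerReynolds_unit_viscosity {Y : ℝ} (hY : 0 ≤ Y) (θ A : ℝ) :
    burgersLayerReynolds (θ * Y) A 1 = θ / 2 * sqrt (Y ^ 2 / A) := by
  unfold burgersLayerReynolds
  rw [mul_one, Real.sqrt_div (sq_nonneg Y), Real.sqrt_sq hY]
  ring

/-- **The threshold inequality, `<` shape**: for `γν > 0`, `R < R⋆ ↔ ΔU < 2R⋆√(γν)` — a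
layer-Reynolds gate is an inequality between the velocity jump across the layer and the strain
normal to it. [cite: BeronovKida1996, §II.A (2.2) (p0003 L18–20)] -/
theorem burgersLayerReynolds_lt_iff {γ ν : ℝ} (hγν : 0 < γ * ν) (ΔU Rc : ℝ) :
    burgersLayerReynolds ΔU γ ν < Rc ↔ ΔU < 2 * Rc * sqrt (γ * ν) := by
  unfold burgersLayerReynolds
  have hs : 0 < sqrt (γ * ν) := Real.sqrt_pos.2 hγν
  rw [div_lt_iff₀ hs, div_lt_iff₀ two_pos]
  constructor <;> intro h <;> linarith

/-- **The threshold inequality, `≤` shape**: for `γν > 0`, `R⋆ ≤ R ↔ 2R⋆√(γν) ≤ ΔU`.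
[cite: BeronovKida1996, §II.A (2.2) (p0003 L18–20)] -/
theorem le_burgersLayerReynolds_iff {γ ν : ℝ} (hγν : 0 < γ * ν) (ΔU Rc : ℝ) :
    Rc ≤ burgersLayerReynolds ΔU γ ν ↔ 2 * Rc * sqrt (γ * ν) ≤ ΔU := by
  rw [← not_lt, burgersLayerReynolds_lt_iff hγν, not_lt]

/-! ## §2 Beronov–Kida's nondimensional layer (App. B (B.1)) and the dictionary to the tree -/

namespace BeronovKida1996

/-- BK's Gaussian `h₀(y) = √(2/π) exp(−y²/2)` — the nondimensional vorticity profile of the layer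
(unit of length `δ = √(ν/A)`), normalised so that `∫h₀ = 2` and `U = ∫₀^y h₀` has `U(±∞) = ±1`.
[cite: BeronovKida1996, App. B eq. (B.1) (p0021 L22–26)] -/
def gaussProfile (y : ℝ) : ℝ :=
  sqrt (2 / π) * exp (-(y ^ 2 / 2))

/-- BK's nondimensional shear profile `U(y) = h₋₁(y) = ∫₀^y h₀` («`erf`» in BK's normalisation,
`= erf(y/√2)` in the standard one); velocity unit `Γ/2 = ΔU/2`.
[cite: BeronovKida1996, App. B eq. (B.1) (p0021 L22–26); §II.A (p0003 L18–19)] -/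
def shearProfile (y : ℝ) : ℝ :=
  ∫ s in (0 : ℝ)..y, gaussProfile s

/-- `h₀ > 0`. [cite: BeronovKida1996, App. B (B.1) (p0021 L25)] -/
theorem gaussProfile_pos (y : ℝ) : 0 < gaussProfile y := by
  unfold gaussProfile
  have : 0 < sqrt (2 / π) := Real.sqrt_pos.2 (by positivity)
  positivity

/-- `h₀` is continuous. [cite: BeronovKida1996, App. B (B.1) (p0021 L25)] -/
theorem continuous_gaussProfile : Continuous gaussProfile := by
  unfold gaussProfile; fun_prop

/-- (Private helper.) The Gaussian `e^{−y²/2}` has derivative `−y e^{−y²/2}`. [folklore] -/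
private theorem hasDerivAt_gauss (y : ℝ) :
    HasDerivAt (fun s : ℝ => exp (-(s ^ 2 / 2))) (-y * exp (-(y ^ 2 / 2))) y := by
  have h1 : HasDerivAt (fun s : ℝ => -(s ^ 2 / 2)) (-y) y := by
    have h : HasDerivAt (fun s : ℝ => s ^ 2) (2 * y) y := by
      simpa using hasDerivAt_pow 2 y
    exact (h.div_const 2).neg.congr_deriv (by ring)
  exact h1.exp.congr_deriv (by ring)

/-- `h₀' = −y·h₀` (so `h₁ = Dh₀ = −y h₀`, (D.1)). [cite: BeronovKida1996, App. D eq. (D.1) (p0025 L27)] -/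
theorem hasDerivAt_gaussProfile (y : ℝ) :
    HasDerivAt gaussProfile (-(y * gaussProfile y)) y := by
  unfold gaussProfile
  exact ((hasDerivAt_gauss y).const_mul (sqrt (2 / π))).congr_deriv (by ring)

/-- `U' = h₀` (fundamental theorem of calculus). [cite: BeronovKida1996, App. B (B.1) (p0021 L25)] -/
theorem hasDerivAt_shearProfile (y : ℝ) : HasDerivAt shearProfile (gaussProfile y) y :=
  (continuous_gaussProfile.integral_hasStrictDerivAt 0 y).hasDerivAt

/-- `U' = h₀` as functions. [cite: BeronovKida1996, App. B (B.1) (p0021 L25)] -/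
theorem deriv_shearProfile : deriv shearProfile = gaussProfile :=
  funext fun y => (hasDerivAt_shearProfile y).deriv

/-- `U'' = −y h₀` (the `U''` entering (2.7)). [cite: BeronovKida1996, App. D (D.1) (p0025 L27)] -/
theorem deriv_deriv_shearProfile (y : ℝ) :
    deriv (deriv shearProfile) y = -(y * gaussProfile y) := by
  rw [deriv_shearProfile]
  exact (hasDerivAt_gaussProfile y).deriv

/-- `U(0) = 0`. [cite: BeronovKida1996, App. B (B.1) (p0021 L25)] -/
@[simp] theorem shearProfile_zero : shearProfile 0 = 0 := by
  simp [shearProfile]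

/-- `U` is odd. [cite: BeronovKida1996, §IV.A («odd profiles», p0013 L10–16)] -/
theorem shearProfile_neg (y : ℝ) : shearProfile (-y) = -shearProfile y := by
  unfold shearProfile
  have h1 : ∫ s in (0 : ℝ)..-y, gaussProfile s = ∫ s in (0 : ℝ)..-y, gaussProfile (-s) :=
    intervalIntegral.integral_congr fun s _ => by simp [gaussProfile]
  rw [h1, intervalIntegral.integral_comp_neg, neg_neg, neg_zero, intervalIntegral.integral_symm]

/-- **`∫h₀ = 2`** ((B.9), first integral). [cite: BeronovKida1996, App. B eq. (B.9) (p0022 L24–25)] -/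
theorem integral_gaussProfile : ∫ y, gaussProfile y = 2 := by
  unfold gaussProfile
  rw [MeasureTheory.integral_const_mul]
  have hexp : ∀ y : ℝ, -(y ^ 2 / 2) = -(1 / 2) * y ^ 2 := fun y => by ring
  simp_rw [hexp]
  rw [integral_gaussian, ← Real.sqrt_mul (by positivity)]
  rw [show (2 : ℝ) / π * (π / (1 / 2)) = 2 ^ 2 by field_simp]
  exact Real.sqrt_sq zero_le_two

/-- **`∫h₀² = 2/√π`** ((B.9), second integral). [cite: BeronovKida1996, App. B eq. (B.9) (p0022 L24–25)] -/
theorem integral_gaussProfile_sq : ∫ y, gaussProfile y ^ 2 = 2 / sqrt π := by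
  have h1 : ∀ y : ℝ, gaussProfile y ^ 2 = 2 / π * exp (-1 * y ^ 2) := by
    intro y
    unfold gaussProfile
    rw [mul_pow, Real.sq_sqrt (by positivity), sq, ← Real.exp_add]
    congr 1
    ring_nf
  simp_rw [h1]
  rw [MeasureTheory.integral_const_mul, integral_gaussian 1, div_one]
  have hπ : sqrt π ≠ 0 := (Real.sqrt_pos.2 Real.pi_pos).ne'
  have hs : sqrt π * sqrt π = π := Real.mul_self_sqrt Real.pi_pos.le
  rw [div_mul_eq_mul_div, div_eq_div_iff Real.pi_pos.ne' hπ]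
  linear_combination 2 * hs

/-- **`U(+∞) = 1`**: `∫₀^∞ h₀ = 1`. [cite: BeronovKida1996, §II.A («`U(+∞) = Γ/2`» as the velocity unit, p0003 L18–19); (B.1)] -/
theorem tendsto_shearProfile_atTop : Tendsto shearProfile atTop (𝓝 1) := by
  have hexp : ∀ y : ℝ, -(y ^ 2 / 2) = -(1 / 2) * y ^ 2 := fun y => by ring
  have hint : IntegrableOn gaussProfile (Ioi 0) := by
    unfold gaussProfile
    simp_rw [hexp]
    exact ((integrable_exp_neg_mul_sq (by norm_num : (0 : ℝ) < 1 / 2)).const_mul _).integrableOn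
  have hval : ∫ y in Ioi (0 : ℝ), gaussProfile y = 1 := by
    unfold gaussProfile
    simp_rw [hexp]
    rw [MeasureTheory.integral_const_mul, integral_gaussian_Ioi]
    rw [show sqrt (2 / π) * (sqrt (π / (1 / 2)) / 2) = sqrt (2 / π * (π / (1 / 2))) / 2 by
      rw [Real.sqrt_mul (by positivity)]; ring]
    rw [show (2 : ℝ) / π * (π / (1 / 2)) = 2 ^ 2 by field_simp, Real.sqrt_sq zero_le_two]
    norm_num
  have hlim := intervalIntegral_tendsto_integral_Ioi 0 hint tendsto_id
  rw [hval] at hlim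
  exact hlim

/-- **`U(−∞) = −1`**. [cite: BeronovKida1996, §II.A (p0003 L18–19); (B.1)] -/
theorem tendsto_shearProfile_atBot : Tendsto shearProfile atBot (𝓝 (-1)) := by
  have h : shearProfile = fun y => -shearProfile (-y) := by
    funext y; rw [shearProfile_neg, neg_neg]
  rw [h]
  exact (tendsto_shearProfile_atTop.comp tendsto_neg_atBot_atTop).neg

/-- **DICTIONARY — BK's nondimensional layer is the tree's Burgers layer**: measuring lengths in
the layer thickness `δ = burgersLayerThickness γ ν = √(ν/γ)` and velocities in the half-jump,
`burgersLayerProfile γ ν ΔU (δ·y) = (ΔU/2)·U(y)` for `γ, ν > 0`.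
[cite: BeronovKida1996, §II.A (2.1)–(2.2) (p0003 L13–20); App. B (B.1)] -/
theorem burgersLayerProfile_thickness_mul {γ ν : ℝ} (hγ : 0 < γ) (hν : 0 < ν) (ΔU y : ℝ) :
    burgersLayerProfile γ ν ΔU (burgersLayerThickness γ ν * y) = ΔU / 2 * shearProfile y := by
  unfold burgersLayerProfile shearProfile gaussProfile burgersLayerThickness burgersLayerRate
  have hs2 : 0 < sqrt 2 := Real.sqrt_pos.2 two_pos
  have h22 : sqrt 2 * sqrt 2 = 2 := Real.mul_self_sqrt zero_le_two
  -- `κ·δ = 1/√2`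
  have hκδ : sqrt (γ / (2 * ν)) * sqrt (ν / γ) = (sqrt 2)⁻¹ := by
    rw [← Real.sqrt_mul (by positivity), show γ / (2 * ν) * (ν / γ) = 1 / 2 by field_simp,
      Real.sqrt_div zero_le_one, Real.sqrt_one, one_div]
  rw [← mul_assoc, hκδ]
  -- change of variables `t = s/√2` in the Gaussian primitive
  have hcv : ∫ t in (0 : ℝ)..((sqrt 2)⁻¹ * y), exp (-t ^ 2) =
      (sqrt 2)⁻¹ * ∫ s in (0 : ℝ)..y, exp (-(s ^ 2 / 2)) := by
    have h := intervalIntegral.integral_comp_div (f := fun t : ℝ => exp (-t ^ 2))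
      (a := 0) (b := y) hs2.ne'
    rw [zero_div, smul_eq_mul] at h
    rw [show (sqrt 2)⁻¹ * y = y / sqrt 2 by rw [div_eq_inv_mul], eq_inv_mul_iff_mul_eq₀ hs2.ne',
      ← h]
    refine intervalIntegral.integral_congr fun s _ => ?_
    simp only [div_pow, Real.sq_sqrt zero_le_two]
  have hinv : (sqrt 2)⁻¹ = sqrt 2 / 2 := by
    rw [inv_eq_one_div, div_eq_div_iff hs2.ne' two_ne_zero, one_mul, h22]
  rw [hcv, intervalIntegral.integral_const_mul, Real.sqrt_div zero_le_two, hinv]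
  ring

/-! ## §3 The normal-mode problem (BK (2.6)–(2.10)) and 2-D linear stability — DEFINITIONS -/

/-- The «Laplacian» of a normal mode, `∇²_α f = f'' − α² f` ((2.8); a modified Helmholtz
operator), on complex amplitude functions of the real cross-layer variable.
[cite: BeronovKida1996, §II.B eq. (2.8) (p0005 L1–5)] -/
def modeLaplacian (α : ℝ) (f : ℝ → ℂ) (y : ℝ) : ℂ :=
  deriv (deriv f) y - ((α ^ 2 : ℝ) : ℂ) * f y

/-- **A Beronov–Kida normal mode** of the Burgers vortex layer at Reynolds number `R`, streamwise
wavenumber `α` and complex phase speed `c`: a `C⁴` streamfunction amplitude `φ` (the disturbance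
is `φ(y)e^{iα(x−ct)}`, `u = φ' e^{iα(x−ct)}`, `v = iαφ e^{iα(x−ct)}`, (2.6)) solving the modified
Orr–Sommerfeld equation (2.7)
`(D² + yD + 1 − α²)(φ'' − α²φ) − iαR((U − c)(φ'' − α²φ) − U''φ) = 0`
about BK's profile `U = shearProfile` (`U'' = −y·h₀`), whose vorticity `ω = φ'' − α²φ` decays at
least exponentially at infinity ((2.10): `|ω(y)| < A|y|^p e^{−σ|y|}`, read as a condition for
large `|y|`). Units: length `δ = √(ν/A)`, velocity `Γ/2`.
[cite: BeronovKida1996, §II.B eqs. (2.6)–(2.7), (2.9)–(2.10) (p0004 L30 – p0005 L13)] -/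
structure IsNormalMode (R α : ℝ) (c : ℂ) (φ : ℝ → ℂ) : Prop where
  contDiff : ContDiff ℝ 4 φ
  ode : ∀ y : ℝ,
    deriv (deriv (modeLaplacian α φ)) y + (y : ℂ) * deriv (modeLaplacian α φ) y
        + ((1 - α ^ 2 : ℝ) : ℂ) * modeLaplacian α φ y
      - Complex.I * ((α * R : ℝ) : ℂ) *
        ((((shearProfile y : ℝ) : ℂ) - c) * modeLaplacian α φ y
          - ((-(y * gaussProfile y) : ℝ) : ℂ) * φ y) = 0
  decay : ∃ σ A p y₀ : ℝ, 0 < σ ∧ ∀ y : ℝ, y₀ ≤ |y| →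
    ‖modeLaplacian α φ y‖ ≤ A * |y| ^ p * exp (-(σ * |y|))

/-- The **exponential growth rate** `α·cᵢ` of the mode `φ(y)e^{iα(x−ct)}`.
[cite: BeronovKida1996, §II.B (p0004 L31: «The exponential growth rate of the mode is `αcᵢ`»)] -/
def growthRate (α : ℝ) (c : ℂ) : ℝ :=
  α * c.im

/-- A normal mode is **nontrivial** when its vorticity `ω = φ'' − α²φ` is not identically zero
(BK pose the eigenvalue problem in terms of `ω`, (2.9), p0005 L9–11).
[cite: BeronovKida1996, §II.B (2.9) (p0005 L6–11)] -/
def IsNontrivialMode (α : ℝ) (φ : ℝ → ℂ) : Prop :=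
  ∃ y : ℝ, modeLaplacian α φ y ≠ 0

/-- **Two-dimensional linear (normal-mode) stability of the Burgers vortex layer at Reynolds number
`R`**: no nontrivial normal mode with `α > 0` grows (`α cᵢ ≤ 0` for every mode). BK's question
(«unconditional stability below a critical Reynolds number», abstract p0001 L10–11).
[cite: BeronovKida1996, abstract (p0001 L8–14); §II.B (p0004 L13–31)] -/
def IsLinearlyStable2D (R : ℝ) : Prop :=
  ∀ α : ℝ, 0 < α → ∀ (c : ℂ) (φ : ℝ → ℂ), IsNormalMode R α c φ → IsNontrivialMode α φ →
    growthRate α c ≤ 0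

/-- A point `(α, R)` of the **neutral curve**: a nontrivial normal mode with `cᵢ = 0` exists (BK
compute neutral STANDING waves, `c = 0`, §IV.A). [cite: BeronovKida1996, §IV.A–C (p0012 L11 – p0016 L31)] -/
def IsNeutralPoint (α R : ℝ) : Prop :=
  ∃ (c : ℂ) (φ : ℝ → ℂ), IsNormalMode R α c φ ∧ IsNontrivialMode α φ ∧ c.im = 0

/-- The PREDICATE «`Rc` is the critical Reynolds number of the Burgers vortex layer for 2-D normal
modes»: linearly stable at every `0 < R < Rc`, not linearly stable at every `R > Rc` (no lower
neutral branch). Beronov–Kida's printed conclusion is `IsCriticalReynolds 1`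
(= `IsCriticalReynolds criticalReynolds`); it rests on formal long-wave asymptotics ((3.21)) and a
shooting computation (§IV.C) and is NOT asserted in this file.
[cite: BeronovKida1996, §IV.C (p0016 L29–31); abstract (p0001 L10–12)] -/
def IsCriticalReynolds (Rc : ℝ) : Prop :=
  (∀ R : ℝ, 0 < R → R < Rc → IsLinearlyStable2D R) ∧ (∀ R : ℝ, Rc < R → ¬ IsLinearlyStable2D R)

/-- The zero amplitude solves (2.7) for every `(R, α, c)` — which is why stability is a statement
about NONTRIVIAL modes. [cite: BeronovKida1996, §II.B (2.7) (p0004 L34–38)] -/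
theorem isNormalMode_zero (R α : ℝ) (c : ℂ) : IsNormalMode R α c (fun _ => 0) := by
  have h0 : modeLaplacian α (fun _ => (0 : ℂ)) = fun _ => 0 := by
    funext y; simp [modeLaplacian]
  refine ⟨contDiff_const, fun y => ?_, ⟨1, 0, 0, 0, one_pos, fun y _ => ?_⟩⟩
  · simp [h0]
  · simp [h0]

/-- The zero amplitude is not a nontrivial mode. [cite: BeronovKida1996, §II.B (2.9) (p0005 L6–11)] -/
theorem not_isNontrivialMode_zero (α : ℝ) : ¬ IsNontrivialMode α (fun _ => 0) := by
  rintro ⟨y, hy⟩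
  simp [modeLaplacian] at hy

/-! ## §4 The Hermite ladder of the long-wave analysis (BK App. B (B.8), §III.A (3.13)) — PROVED -/

/-- BK's **Hermite operator** `𝓜 = D(D + y) = D² + yD + 1` ((3.5)) — the `x`-independent
(`α = 0`) part `(D² + yD + 1 − α²)|_{α=0}` of the vorticity operator in (2.7): strain advection
`yD + 1 = D∘y` plus diffusion `D²`. [cite: BeronovKida1996, §III.A eq. (3.5) (p0006 L5); App. B (B.8) (p0022 L18)] -/
def hermiteOp (f : ℝ → ℝ) (y : ℝ) : ℝ :=
  deriv (deriv f) y + y * deriv f y + f y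

/-- BK's **Hermite functions** `hₙ = Dⁿh₀` ((B.8)), here for the un-normalised Gaussian
`e^{−y²/2}` (BK's `hₙ` is `√(2/π)` times this one, (B.1); the eigen-relation is scale-free).
[cite: BeronovKida1996, App. B eq. (B.8) (p0022 L17)] -/
def hermiteFn (n : ℕ) : ℝ → ℝ :=
  deriv^[n] fun y => exp (-(y ^ 2 / 2))

/-- `h₀ = e^{−y²/2}`. [cite: BeronovKida1996, App. B (B.1), (B.8) (p0021 L25, p0022 L17)] -/
@[simp] theorem hermiteFn_zero : hermiteFn 0 = fun y => exp (-(y ^ 2 / 2)) := rfl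

/-- `hₙ₊₁ = D hₙ`. [cite: BeronovKida1996, App. B (B.8) (p0022 L17)] -/
theorem hermiteFn_succ (n : ℕ) : hermiteFn (n + 1) = deriv (hermiteFn n) := by
  unfold hermiteFn
  rw [Function.iterate_succ_apply']

/-- BK's normalised Gaussian is `√(2/π)·h₀`. [cite: BeronovKida1996, App. B (B.1) (p0021 L25)] -/
theorem gaussProfile_eq (y : ℝ) : gaussProfile y = sqrt (2 / π) * hermiteFn 0 y := rfl

/-- **`hₙ = (−1)ⁿ Heₙ · h₀`** with Mathlib's (probabilists') Hermite polynomial `Heₙ = hermite n`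
(Mathlib `Polynomial.deriv_gaussian_eq_hermite_mul_gaussian`); e.g. `h₁ = −y h₀`,
`h₂ = (y² − 1)h₀` as in (D.1). [cite: BeronovKida1996, App. D eq. (D.1) (p0025 L27–30)] -/
theorem hermiteFn_eq_hermite (n : ℕ) (y : ℝ) :
    hermiteFn n y = (-1 : ℝ) ^ n * aeval y (hermite n) * exp (-(y ^ 2 / 2)) :=
  Polynomial.deriv_gaussian_eq_hermite_mul_gaussian n y

/-- (Private helper.) **`Heₙ₊₁' = (n+1)·Heₙ`** for the probabilists' Hermite polynomials (from
Mathlib's recursion `Heₙ₊₁ = X·Heₙ − Heₙ'`; Abramowitz–Stegun 22.8.8). [folklore] -/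
private theorem derivative_hermite_succ (n : ℕ) :
    derivative (hermite (n + 1)) = ((n : ℤ[X]) + 1) * hermite n := by
  induction n with
  | zero => simp [hermite_zero]
  | succ n ih =>
    rw [hermite_succ (n + 1), derivative_sub, derivative_mul, derivative_X, one_mul, ih,
      derivative_mul]
    have hc : derivative ((n : ℤ[X]) + 1) = 0 := by
      rw [derivative_add, derivative_natCast, derivative_one, add_zero]
    rw [hc, zero_mul, zero_add, hermite_succ n]
    push_cast
    ring

/-- (Private helper.) **The Hermite differential equation** `X·Heₙ' − Heₙ'' = n·Heₙ`
(Abramowitz–Stegun 22.6.21). [folklore] -/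
private theorem hermite_diffEq (n : ℕ) :
    X * derivative (hermite n) - derivative (derivative (hermite n)) = (n : ℤ[X]) * hermite n := by
  cases n with
  | zero => simp [hermite_zero]
  | succ n =>
    rw [derivative_hermite_succ, derivative_mul]
    have hc : derivative ((n : ℤ[X]) + 1) = 0 := by
      rw [derivative_add, derivative_natCast, derivative_one, add_zero]
    rw [hc, zero_mul, zero_add, hermite_succ n]
    push_cast
    ring

/-- (Private helper.) Derivative of `y ↦ c·P(y)·e^{−y²/2}` for a polynomial `P`:
`c·(P' − X·P)(y)·e^{−y²/2}`. [folklore] -/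
private theorem deriv_const_mul_aeval_mul_gauss (c : ℝ) (P : ℤ[X]) :
    deriv (fun y : ℝ => c * aeval y P * exp (-(y ^ 2 / 2))) =
      fun y => c * aeval y (derivative P - X * P) * exp (-(y ^ 2 / 2)) := by
  funext y
  have hP : HasDerivAt (fun s : ℝ => c * aeval s P) (c * aeval y (derivative P)) y :=
    (Polynomial.hasDerivAt_aeval P y).const_mul c
  have h : HasDerivAt (fun s : ℝ => c * aeval s P * exp (-(s ^ 2 / 2)))
      (c * aeval y (derivative P) * exp (-(y ^ 2 / 2)) + c * aeval y P * (-y * exp (-(y ^ 2 / 2))))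
      y := hP.mul (hasDerivAt_gauss y)
  rw [h.deriv]
  simp only [map_sub, map_mul, aeval_X]
  ring

/-- **`𝓜` on the Gaussian–polynomial class**: `𝓜(c·P·h₀) = c·(P'' − X·P')·h₀` — the strain
advection `D∘y` and the diffusion `D²` leave only the Hermite-equation combination of `P`.
[cite: BeronovKida1996, App. B (B.2)–(B.3), (B.8) (p0021 L28 – p0022 L19)] -/
theorem hermiteOp_const_mul_aeval_mul_gauss (c : ℝ) (P : ℤ[X]) (y : ℝ) :
    hermiteOp (fun s : ℝ => c * aeval s P * exp (-(s ^ 2 / 2))) y =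
      c * aeval y (derivative (derivative P) - X * derivative P) * exp (-(y ^ 2 / 2)) := by
  unfold hermiteOp
  rw [deriv_const_mul_aeval_mul_gauss c P, deriv_const_mul_aeval_mul_gauss c (derivative P - X * P)]
  simp only [map_sub, map_mul, map_add, aeval_X, derivative_mul, derivative_X, one_mul]
  ring

/-- **The Hermite ladder (BK (B.8)): `𝓜hₙ = −n·hₙ` for every `n`.** To leading order in the
wavenumber the vorticity modes of the Burgers layer are these `hₙ` with `λ₀ = −n` ((3.13)):
«very strong damping» `α cᵢ = −n/R` for `n ≥ 1`, and the only leading-order-neutral mode is the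
Gaussian `h₀` — the layer-strength mode about which (3.21) decides `R₀` (BK: «(B.8) follows
inductively … by noting that `D𝓜Dⁿ = (𝓜 + 1)Dⁿ⁺¹`»; here via `hₙ = (−1)ⁿHeₙh₀` and the Hermite
equation). Completeness of the ladder among fast-decaying eigenfunctions ((B.5)) is NOT proved
here. [cite: BeronovKida1996, App. B eq. (B.8) (p0022 L17–19); §III.A (3.13)–(3.14) (p0007 L14–30)] -/
theorem hermiteOp_hermiteFn (n : ℕ) (y : ℝ) :
    hermiteOp (hermiteFn n) y = -(n : ℝ) * hermiteFn n y := by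
  have hfun : hermiteFn n = fun s : ℝ => (-1 : ℝ) ^ n * aeval s (hermite n) * exp (-(s ^ 2 / 2)) :=
    funext fun s => hermiteFn_eq_hermite n s
  rw [hfun, hermiteOp_const_mul_aeval_mul_gauss]
  beta_reduce
  have hode : derivative (derivative (hermite n)) - X * derivative (hermite n) =
      -((n : ℤ[X]) * hermite n) := by
    rw [← hermite_diffEq n]; ring
  rw [hode]
  simp only [map_neg, map_mul, map_natCast]
  ring

/-- **The Gaussian (layer-strength) mode is neutral to leading order: `𝓜h₀ = 0`** ((3.13), `n = 0`;
BK: «For the only mode which is neutrally stable to leading order … `λ₀ = 0`,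
`ω₀ = h₀ − iR₀h₁`», (3.14)). [cite: BeronovKida1996, §III.A (3.13)–(3.14) (p0007 L20–30)] -/
theorem hermiteOp_hermiteFn_zero (y : ℝ) : hermiteOp (hermiteFn 0) y = 0 := by
  simpa using hermiteOp_hermiteFn 0 y

/-- The same for BK's normalised `h₀ = gaussProfile`: `𝓜(gaussProfile) = 0`.
[cite: BeronovKida1996, §III.A (3.13)–(3.14) (p0007 L20–30); (B.1)] -/
theorem hermiteOp_gaussProfile (y : ℝ) : hermiteOp gaussProfile y = 0 := by
  have h : gaussProfile = fun s : ℝ => sqrt (2 / π) * aeval s (hermite 0) * exp (-(s ^ 2 / 2)) := by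
    funext s; simp [gaussProfile, hermite_zero]
  rw [h, hermiteOp_const_mul_aeval_mul_gauss]
  simp [hermite_zero]

/-- **Every other rung is damped: `𝓜h₁ = −h₁`** (the layer-displacement mode, odd).
[cite: BeronovKida1996, §III.A (3.13) (p0007 L20–24); (B.8)] -/
theorem hermiteOp_hermiteFn_one (y : ℝ) : hermiteOp (hermiteFn 1) y = -hermiteFn 1 y := by
  simpa using hermiteOp_hermiteFn 1 y

/-! ## §5 The printed numbers — DATA, with the checks that are arithmetic -/

/-- **DATA: the printed critical Reynolds number `R_cr = 1`** of the Burgers vortex layer for 2-D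
normal modes («a finite critical Reynolds number exists, `R_cr = 1`. It is obtained at the
small-wavenumber end of the neutral curve, and no lower branch exists, at least for standing wave
normal modes», §IV.C; `R₀ = 1` from the second-order solvability condition (3.21); = Neu's 1984
long-wave threshold `R'_cr = √(2π)` in Neu's units, p0003 L21–22). A printed value, NOT a theorem
of this file (see `IsCriticalReynolds`).
[cite: BeronovKida1996, §IV.C (p0016 L29–31); §III.A eq. (3.21) (p0009 L1–5); abstract (p0001 L10–12)] -/
def criticalReynolds : ℝ := 1

/-- **The arithmetic of (3.21)**: the second-order solvability relation «`0 = 2(λ₂ − R₀²)`» with the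
neutral-curve normalisation `λ₂ = 1` ((3.6)) and `R₀ ≥ 0` ((3.4)) forces `R₀ = 1`.
[cite: BeronovKida1996, §III.A eq. (3.21) (p0009 L1–5) with (3.4), (3.6) (p0006 L1–12)] -/
theorem longWave_R0_eq_one {lam2 R0 : ℝ} (hsolv : 2 * (lam2 - R0 ^ 2) = 0) (hlam2 : lam2 = 1)
    (hR0 : 0 ≤ R0) : R0 = criticalReynolds := by
  unfold criticalReynolds
  subst hlam2
  have h1 : R0 ^ 2 = 1 := by linarith
  exact (pow_eq_one_iff_of_nonneg hR0 two_ne_zero).1 h1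

/-- **DATA: the slope of the neutral curve at the long-wave end**, `R₁ = 3/√π`:
`R(α) = 1 + (3/√π)α + O(α²)` ((3.24)), printed as `= 1.6926`; «`R₁ > 0` indeed» — the neutral
curve LEAVES `R = 1` with positive slope (no lower branch to this order).
[cite: BeronovKida1996, §III.A eq. (3.24) (p0010 L1–4)] -/
def neutralSlopeLongWave : ℝ := 3 / sqrt π

/-- `R₁ > 0`. [cite: BeronovKida1996, §III.A (3.24) (p0010 L2: «`R₁ > 0` indeed»)] -/
theorem neutralSlopeLongWave_pos : 0 < neutralSlopeLongWave := by
  unfold neutralSlopeLongWave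
  have : 0 < sqrt π := Real.sqrt_pos.2 Real.pi_pos
  positivity

/-- The printed decimal: `|3/√π − 1.6926| < 10⁻⁴`. [cite: BeronovKida1996, §III.A (3.24) (p0010 L2: «`R₁ = 3/√π = 1.6926`»)] -/
theorem abs_neutralSlopeLongWave_sub_lt : |neutralSlopeLongWave - 1.6926| < 1e-4 := by
  unfold neutralSlopeLongWave
  have hπlo : 3.141592 < π := Real.pi_gt_d6
  have hπhi : π < 3.141593 := Real.pi_lt_d6
  have hsπ : 0 < sqrt π := Real.sqrt_pos.2 Real.pi_pos
  have hsq : sqrt π * sqrt π = π := Real.mul_self_sqrt Real.pi_pos.le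
  -- `1.77245 < √π < 1.77246` by squaring
  have hlo : 1.77245 < sqrt π := by nlinarith
  have hhi : sqrt π < 1.77246 := by nlinarith
  have h3 : 3 / sqrt π < 1.6927 := by rw [div_lt_iff₀ hsπ]; linarith
  have h4 : 1.6925 < 3 / sqrt π := by rw [lt_div_iff₀ hsπ]; linarith
  rw [abs_sub_lt_iff]; constructor <;> linarith

/-- **DATA: the inviscid short-wave cutoff** `a₀ = α_cr² = 0.537` (Rayleigh problem, (3.35)); no
inviscid neutral solution exists above `α_cr = √a₀ = 0.733` («the upper bound for the wavenumbers
of the neutral disturbances», p0016 L32–33). [cite: BeronovKida1996, §III.B eq. (3.35) (p0011 L24–26)] -/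
def inviscidCutoffSq : ℝ := 0.537

/-- **DATA: `α_cr = 0.733`** as printed. [cite: BeronovKida1996, §III.B eq. (3.35) (p0011 L26); §IV.B (p0015 L38–39)] -/
def inviscidCutoff : ℝ := 0.733

/-- Consistency of the printed pair: `|√0.537 − 0.733| < 10⁻³`. [cite: BeronovKida1996, §III.B (3.35) (p0011 L26: «`α_cr = √a₀ = 0.733`»)] -/
theorem abs_sqrt_inviscidCutoffSq_sub_lt : |sqrt inviscidCutoffSq - inviscidCutoff| < 1e-3 := by
  unfold inviscidCutoffSq inviscidCutoff
  have hs : 0 ≤ sqrt (0.537 : ℝ) := Real.sqrt_nonneg _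
  have hsq : sqrt (0.537 : ℝ) * sqrt 0.537 = 0.537 := Real.mul_self_sqrt (by norm_num)
  have hlo : 0.7327 < sqrt (0.537 : ℝ) := by nlinarith
  have hhi : sqrt (0.537 : ℝ) < 0.7329 := by nlinarith
  rw [abs_sub_lt_iff]; constructor <;> linarith

/-- **DATA: the first-order inviscid correction** `a₁ = −0.927` ((3.38)), giving the large-`R`
asymptote of the neutral curve `α_cr(R) = 0.733 − 0.863/R + O(R⁻²)` ((3.39), with
`ε = 1/(αR)`, `α_cr = √a₀ + εa₁/(2√a₀)`, (3.32)).
[cite: BeronovKida1996, §III.B eqs. (3.38)–(3.39) (p0012 L5–9)] -/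
def inviscidFirstOrderCoeff : ℝ := -0.927

/-- **DATA: `0.863`**, the printed coefficient of `1/R` in (3.39). [cite: BeronovKida1996, §III.B eq. (3.39) (p0012 L9)] -/
def largeReynoldsSlope : ℝ := 0.863

/-- Consistency of (3.38) with (3.39): `εa₁/(2√a₀) = a₁/(2a₀)·(1/R)` at `α = √a₀`, and
`|0.927/(2·0.537) − 0.863| < 10⁻³`. [cite: BeronovKida1996, §III.B (3.32), (3.38)–(3.39) (p0010 L20–21, p0012 L5–9)] -/
theorem abs_inviscidFirstOrderCoeff_div_sub_lt :
    |(-inviscidFirstOrderCoeff) / (2 * inviscidCutoffSq) - largeReynoldsSlope| < 1e-3 := by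
  unfold inviscidFirstOrderCoeff inviscidCutoffSq largeReynoldsSlope
  rw [abs_sub_lt_iff]; constructor <;> norm_num

/-- **DATA: neutral wavenumbers on the computed neutral curve** (§IV.C): triples
`(R, α BK shooting, α Lin–Corcos 1984 rescaled)` = `(5, 0.57, 0.53)`, `(10, 0.65, 0.63)`,
`(20, 0.69, 0.69)`; at `R = ∞` both give `0.73` (= `inviscidCutoff`). The layer is unstable at
`(α, R)` with `R > 1` only inside the long-wave band below the neutral curve (Fig. 2; «The
numerical curve is strictly monotonic»). Printed numbers (one shooting code, 6 digits claimed for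
`α < 0.5`; «an increasing discrepancy [with Lin–Corcos] … when the Reynolds number falls below 20»).
[cite: BeronovKida1996, §IV.C (p0016 L18–31)] -/
def neutralWavenumberTable : List (ℝ × ℝ × ℝ) :=
  [(5, 0.57, 0.53), (10, 0.65, 0.63), (20, 0.69, 0.69)]

/-- **DATA: Neu's long-wave threshold in Neu's units**, `R'_cr = √(2π)` with `R' = Γδ'/ν`,
`δ' = δ√π/2` — «corresponds to `R_cr = 1` here» (BK's sentence; the unit conversion is theirs and
is not re-derived in this file). [cite: BeronovKida1996, §II.A (p0003 L21–22)] [cite: Neu1984, long-wave stability threshold (quoted from BeronovKida1996 p0003 L21–22)] -/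
def neuCriticalReynolds : ℝ := sqrt (2 * π)

end BeronovKida1996

end Literature.Analysis.FluidPDE
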